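import Summits.HodgeConjecture.CorCM.IrreducibleOddWeightsDichotomy
import HarnessLib

/-!
# Restriction of a family of CM types to a sub-family: the rank never grows, and it is UNCHANGED iff the dropped type
# vectors are EQUIVARIANT IMAGES of the kept ones

COR-CM (cell `pub-hodgecm2`, binder seat `b16` gen 56, count-neutral claim MAX-NONDEG (D-RANK), file F1 — abstract
`G`-set level of `Literature/NumberTheory/ComplexMultiplication/CMTypeRankFamilies` (a group `G` acting slot by slot
on `⊔_i E_i`, types `Φ_i ⊆ E_i`, the family type `Σ = sigmaType Φ`, Shimura's antisymmetric spans
`U(Φ_i) = antiSpan G (Φ_i) = span{u_g(Φ_i)}`, `U(Σ)`, `rank = dim U + 1`); theorems only, no definition, no named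
fact, no `sorry`).  NEW as stated, hence under `Summits/`.  HONEST FRAMING: finite-dimensional linear algebra about the
Kubota–Dodson rank of families of CM types, read on Hodge groups of products of abelian varieties with complex
multiplication (`dim Hg(∏_i A_i) = rank − 1`); NO hypothesis on the slots in this file (any CM fields, any types);
`HC_CM` is neither used nor asserted.

REINDEXING / SUB-FAMILIES.  For a map of index sets `ι : J → I` the reindexed family `(Φ_{ι j})_{j ∈ J}` on the slots
`(E_{ι j})_j` has family type `Σ_ι = sigmaType (Φ ∘ ι)`, and the linear RESTRICTION
`R_ι : ℚ^{⊔_i E_i} → ℚ^{⊔_j E_{ι j}}`, `(R_ι f)(j, s) = f(ι j, s)` (`LinearMap.funLeft` along `(j, s) ↦ (ι j, s)`) is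
`G`-equivariant and carries `u_g(Σ)` to `u_g(Σ_ι)`.  A sub-family is the case `ι = Subtype.val : {i // p i} → I`.

* §1 `funLeft_reindex_antiVec_sigmaType`, **`map_funLeft_reindex_antiSpan_sigmaType`** (`R_ι U(Σ) = U(Σ_ι)`: the
  restriction is ONTO — on Hodge groups, `Hg(∏_I A_i) ↠ Hg(∏_J A_{ι j})`), **`finrank_antiSpan_sigmaType_reindex_le`**
  (`dim U(Σ_ι) ≤ dim U(Σ)`: a sub-product, or a product repeating factors, never has the larger Hodge group),
  `typeRank_sigmaType_reindex_le`.
* §2 **`finrank_antiSpan_sigmaType_eq_reindex_of_generated`** — GENERATION ⟹ NO GROWTH: if every type vector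
  `u_i = u_1(Φ_i)` is an equivariant image of the reindexed ones, `u_i = Σ_j φ_ij(u_{ι j})` with `G`-equivariant linear
  `φ_ij : ℚ^{E_{ι j}} → ℚ^{E_i}`, then `R_ι` is INJECTIVE on `U(Σ)` and `dim U(Σ) = dim U(Σ_ι)`: the equivariant
  recombination `(L h)(i, ·) = Σ_j φ_ij(h(j, ·))` inverts `R_ι` on the generators, hence on `U(Σ)`
  (`finrank_antiSpan_sigmaType_eq_reindex_of_leftInverse`, `eq_zero_of_leftInverse_of_funLeft_reindex_eq_zero`).
  Sub-family form `finrank_antiSpan_sigmaType_eq_restrict_of_generated` (generation asked only OFF `p`).  This is the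
  `k`-slot form of the two-slot collapse of seat gen 45 (`CorCM/ReflexSlotRankCollapse`: `L u_{i₁} = c·u_{i₀}`).
* §3 **`exists_generated_of_finrank_antiSpan_sigmaType_eq_reindex`** — THE CONVERSE: if `dim U(Σ) = dim U(Σ_ι)` then
  such equivariant `φ_ij` EXIST (the inverse `U(Σ_ι) → U(Σ)` of the restriction, precomposed with the EQUIVARIANT
  orthogonal projection of `ℚ^{⊔_j E_{ι j}}` onto `U(Σ_ι)` — seat gen 55 `exists_equivariant_projection` — and read slot
  by slot).  **`finrank_antiSpan_sigmaType_eq_reindex_iff`**, `typeRank_sigmaType_eq_reindex_iff`: for CM types,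
  `rank(Σ) = rank(Σ_ι)` ⟺ every `u_i` is an equivariant combination of the `u_{ι j}` — on Hodge groups:
  `Hg(∏_I A_i) → Hg(∏_J A_{ι j})` is an isogeny iff the dropped factors' type vectors are equivariant images of the kept
  ones (then the dropped factors contribute exceptional classes on the product, never new dimensions).

Sequels: F2 `CorCM/IrreducibleOddWeightsMaximalAdditive` (irreducible slots: EVERY maximal additive sub-family carries
`U(Σ)` isomorphically), F3 `CorCM/IrreducibleOddWeightsDRank` (one (IRR) slot: `dim U(Σ) = t · dim A`, `t` = the rank of
the type vectors over the commutant), CM dresses F4/F5.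

## References

* [Gordon1999HodgeAVSurvey] B. B. Gordon, *A survey of the Hodge conjecture for abelian varieties*, §3 Theorem (Imai,
  Murty) with proof ("`Hg(A)` surjects onto each factor"), 7.5–7.7.
* [Deligne1982HodgeCycles] P. Deligne, *Hodge cycles on abelian varieties*, LNM 900 (1982), I Ex. 3.7 (c).
* [Serre1977] J.-P. Serre, *Linear Representations of Finite Groups*, GTM 42 (1977), §1.3 Thm. 1 (stable complements).
* [Shimura1998] G. Shimura, *Abelian Varieties with Complex Multiplication and Modular Functions*, §32.10.
-/

set_option autoImplicit false

noncomputable section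

open scoped BigOperators

universe u u' v w

namespace Summit.HodgeConjecture.CorCM.IrrOdd

open Literature.NumberTheory.ComplexMultiplication

variable {G : Type w} [Group G] {I : Type u} {J : Type u'} {E : I → Type v} [∀ i, MulAction G (E i)]

/-! ### §1 Restriction to a reindexed family is onto; the rank never grows -/

section Reindex

/-- Restricting the `±1`-vector of a translate of `Σ` along `ι` gives the `±1`-vector of the translate of `Σ_ι`.
[cite: Deligne1982HodgeCycles, I Ex. 3.7 (c) (p. 26)] -/
theorem funLeft_reindex_antiVec_sigmaType (Φ : ∀ i, Set (E i)) (ι : J → I) (g : G) :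
    LinearMap.funLeft ℚ ℚ (fun y : (Σ j, E (ι j)) => (⟨ι y.1, y.2⟩ : Σ i, E i)) (antiVec (sigmaType Φ) g) =
      antiVec (sigmaType fun j => Φ (ι j)) g := by
  funext y
  rw [LinearMap.funLeft_apply, antiVec_sigmaType, antiVec_sigmaType]

/-- **The restriction maps `U(Σ)` ONTO `U(Σ_ι)`** ("`Hg(A)` surjects onto the Hodge group of every sub-product").
[cite: Gordon1999HodgeAVSurvey, §3 Theorem (proof)] -/
theorem map_funLeft_reindex_antiSpan_sigmaType (Φ : ∀ i, Set (E i)) (ι : J → I) :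
    (antiSpan G (sigmaType Φ)).map
        (LinearMap.funLeft ℚ ℚ (fun y : (Σ j, E (ι j)) => (⟨ι y.1, y.2⟩ : Σ i, E i))) =
      antiSpan G (sigmaType fun j => Φ (ι j)) := by
  simp only [antiSpan, Submodule.map_span, ← Set.range_comp, Function.comp_def, funLeft_reindex_antiVec_sigmaType]

/-- The restriction commutes with the action. [folklore] -/
theorem funLeft_reindex_comp_smul (ι : J → I) (f : (Σ i, E i) → ℚ) (g : G) :
    LinearMap.funLeft ℚ ℚ (fun y : (Σ j, E (ι j)) => (⟨ι y.1, y.2⟩ : Σ i, E i)) (fun x => f (g • x)) =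
      fun y => LinearMap.funLeft ℚ ℚ (fun y : (Σ j, E (ι j)) => (⟨ι y.1, y.2⟩ : Σ i, E i)) f (g • y) := by
  funext y
  obtain ⟨j, s⟩ := y
  rfl

variable [Fintype I] [∀ i, Fintype (E i)]

/-- **`dim U(Σ_ι) ≤ dim U(Σ)`**: reindexing a family (passing to a sub-family, repeating members) never enlarges the
antisymmetric span — `dim Hg` of a sub-product is at most `dim Hg` of the product.
[cite: Gordon1999HodgeAVSurvey, §3 Theorem (proof) and 7.5–7.7] -/
theorem finrank_antiSpan_sigmaType_reindex_le (Φ : ∀ i, Set (E i)) (ι : J → I) :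
    Module.finrank ℚ (antiSpan G (sigmaType fun j => Φ (ι j))) ≤ Module.finrank ℚ (antiSpan G (sigmaType Φ)) := by
  rw [← map_funLeft_reindex_antiSpan_sigmaType Φ ι]
  exact Submodule.finrank_map_le _ _

/-- **`rank(Σ_ι) ≤ rank(Σ)`** for CM types (`rank = dim U + 1` on both sides).
[cite: Gordon1999HodgeAVSurvey, 7.5–7.7] [cite: Shimura1998, §32.10] -/
theorem typeRank_sigmaType_reindex_le [Fintype J] {ρ : G} {Φ : ∀ i, Set (E i)} (h : ∀ i, IsCMTypeWith ρ (Φ i))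
    (ι : J → I) [Nonempty (Σ j, E (ι j))] :
    typeRank G (sigmaType fun j => Φ (ι j)) ≤ typeRank G (sigmaType Φ) := by
  obtain ⟨⟨j₀, s₀⟩⟩ := ‹Nonempty (Σ j, E (ι j))›
  haveI : Nonempty (Σ i, E i) := ⟨⟨ι j₀, s₀⟩⟩
  rw [(IsCMTypeWith.sigmaType h).typeRank_eq_finrank_antiSpan_add_one,
    (IsCMTypeWith.sigmaType (E := fun j => E (ι j)) fun j => h (ι j)).typeRank_eq_finrank_antiSpan_add_one]
  exact Nat.add_le_add_right (finrank_antiSpan_sigmaType_reindex_le Φ ι) 1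

end Reindex

/-! ### §2 Generation ⟹ the restriction is injective on `U(Σ)` -/

section Generated

/-- Under a linear left inverse `L` of the restriction on the generators `u_g(Σ)`, `L ∘ R_ι` fixes `U(Σ)`.
[cite: Gordon1999HodgeAVSurvey, §3 Theorem (proof)] -/
theorem apply_funLeft_reindex_eq_self_of_leftInverse (Φ : ∀ i, Set (E i)) (ι : J → I)
    (L : ((Σ j, E (ι j)) → ℚ) →ₗ[ℚ] ((Σ i, E i) → ℚ))
    (hL : ∀ g : G, L (LinearMap.funLeft ℚ ℚ (fun y : (Σ j, E (ι j)) => (⟨ι y.1, y.2⟩ : Σ i, E i))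
      (antiVec (sigmaType Φ) g)) = antiVec (sigmaType Φ) g)
    {f : (Σ i, E i) → ℚ} (hf : f ∈ antiSpan G (sigmaType Φ)) :
    L (LinearMap.funLeft ℚ ℚ (fun y : (Σ j, E (ι j)) => (⟨ι y.1, y.2⟩ : Σ i, E i)) f) = f := by
  rw [antiSpan] at hf
  refine Submodule.span_induction (fun _ ⟨g, hg⟩ => hg ▸ hL g) (by rw [map_zero, map_zero])
    (fun a b _ _ ha hb => by rw [map_add, map_add, ha, hb]) (fun c a _ ha => by rw [map_smul, map_smul, ha]) hf

/-- **A member of `U(Σ)` with vanishing restriction vanishes**, under a left inverse on the generators.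
[cite: Gordon1999HodgeAVSurvey, §3 Theorem (proof)] -/
theorem eq_zero_of_leftInverse_of_funLeft_reindex_eq_zero (Φ : ∀ i, Set (E i)) (ι : J → I)
    (L : ((Σ j, E (ι j)) → ℚ) →ₗ[ℚ] ((Σ i, E i) → ℚ))
    (hL : ∀ g : G, L (LinearMap.funLeft ℚ ℚ (fun y : (Σ j, E (ι j)) => (⟨ι y.1, y.2⟩ : Σ i, E i))
      (antiVec (sigmaType Φ) g)) = antiVec (sigmaType Φ) g)
    {f : (Σ i, E i) → ℚ} (hf : f ∈ antiSpan G (sigmaType Φ))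
    (h0 : LinearMap.funLeft ℚ ℚ (fun y : (Σ j, E (ι j)) => (⟨ι y.1, y.2⟩ : Σ i, E i)) f = 0) : f = 0 := by
  rw [← apply_funLeft_reindex_eq_self_of_leftInverse Φ ι L hL hf, h0, map_zero]

/-- **A left inverse of the restriction on the generators inverts it on `U(Σ)`**: then `R_ι` is injective on `U(Σ)`
and `dim U(Σ) = dim U(Σ_ι)`. [cite: Gordon1999HodgeAVSurvey, §3 Theorem (proof)] -/
theorem finrank_antiSpan_sigmaType_eq_reindex_of_leftInverse [Fintype I] [∀ i, Fintype (E i)]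
    (Φ : ∀ i, Set (E i)) (ι : J → I)
    (L : ((Σ j, E (ι j)) → ℚ) →ₗ[ℚ] ((Σ i, E i) → ℚ))
    (hL : ∀ g : G, L (LinearMap.funLeft ℚ ℚ (fun y : (Σ j, E (ι j)) => (⟨ι y.1, y.2⟩ : Σ i, E i))
      (antiVec (sigmaType Φ) g)) = antiVec (sigmaType Φ) g) :
    Module.finrank ℚ (antiSpan G (sigmaType Φ)) = Module.finrank ℚ (antiSpan G (sigmaType fun j => Φ (ι j))) := by
  have hinj : Function.Injective
      (LinearMap.funLeft ℚ ℚ (fun y : (Σ j, E (ι j)) => (⟨ι y.1, y.2⟩ : Σ i, E i)) ∘ₗ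
        (antiSpan G (sigmaType Φ)).subtype) := by
    intro a b hab
    apply Subtype.ext
    have := congrArg L hab
    simp only [LinearMap.comp_apply, Submodule.subtype_apply] at this
    rwa [apply_funLeft_reindex_eq_self_of_leftInverse Φ ι L hL a.2,
      apply_funLeft_reindex_eq_self_of_leftInverse Φ ι L hL b.2] at this
  have hrange : LinearMap.range
      (LinearMap.funLeft ℚ ℚ (fun y : (Σ j, E (ι j)) => (⟨ι y.1, y.2⟩ : Σ i, E i)) ∘ₗ
        (antiSpan G (sigmaType Φ)).subtype) = antiSpan G (sigmaType fun j => Φ (ι j)) := by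
    rw [LinearMap.range_comp, Submodule.range_subtype, map_funLeft_reindex_antiSpan_sigmaType]
  rw [← hrange]
  exact (LinearMap.finrank_range_of_inj hinj).symm

/-- The image of the `±1`-vector of the translate of `Φ_{ι j}` by `g` under an equivariant `φ : ℚ^{E_{ι j}} → ℚ^{E_i}`
is `φ(u_1) ∘ (g • ·)`. [cite: Deligne1982HodgeCycles, I Ex. 3.7 (c) (p. 26)] -/
theorem apply_antiVec_eq_comp_smul {Y Z : Type*} [MulAction G Y] (Ψ : Set Y) (φ : (Y → ℚ) →ₗ[ℚ] (Z → ℚ))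
    {act : G → Z → Z} (hφ : ∀ (g : G) (f : Y → ℚ), φ (fun y => f (g • y)) = fun z => φ f (act g z)) (g : G) :
    φ (antiVec Ψ g) = fun z => φ (antiVec Ψ (1 : G)) (act g z) := by
  rw [← hφ g]
  congr 1
  funext y
  rw [antiVec_apply_smul, one_mul]

variable [Fintype J]

/-- **GENERATION ⟹ NO GROWTH.**  If every type vector is an equivariant combination of the reindexed ones —
`u_1(Φ_i) = Σ_j φ_ij(u_1(Φ_{ι j}))` with `G`-equivariant linear `φ_ij : ℚ^{E_{ι j}} → ℚ^{E_i}` — then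
`dim U(Σ) = dim U(Σ_ι)` (the equivariant recombination `(L h)(i, ·) = Σ_j φ_ij(h(j, ·))` is a left inverse of the
restriction on every generator `u_g(Σ)`, by equivariance).  On Hodge groups: `Hg(∏_I A_i) → Hg(∏_J A_{ι j})` is an
isogeny. [cite: Gordon1999HodgeAVSurvey, §3 Theorem (proof) and 7.5–7.7] -/
theorem finrank_antiSpan_sigmaType_eq_reindex_of_generated [Fintype I] [∀ i, Fintype (E i)]
    (Φ : ∀ i, Set (E i)) (ι : J → I)
    (φ : ∀ (i : I) (j : J), (E (ι j) → ℚ) →ₗ[ℚ] (E i → ℚ))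
    (hφ : ∀ i j (g : G) (f : E (ι j) → ℚ), φ i j (fun y => f (g • y)) = fun z => φ i j f (g • z))
    (hgen : ∀ i, antiVec (Φ i) (1 : G) = ∑ j, φ i j (antiVec (Φ (ι j)) (1 : G))) :
    Module.finrank ℚ (antiSpan G (sigmaType Φ)) = Module.finrank ℚ (antiSpan G (sigmaType fun j => Φ (ι j))) := by
  classical
  -- the recombination map, slot by slot
  let Lx : (Σ i, E i) → ((Σ j, E (ι j)) → ℚ) →ₗ[ℚ] ℚ := fun x =>
    (LinearMap.proj x.2 : (E x.1 → ℚ) →ₗ[ℚ] ℚ) ∘ₗ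
      ∑ j, φ x.1 j ∘ₗ LinearMap.funLeft ℚ ℚ (fun t : E (ι j) => (⟨j, t⟩ : Σ j, E (ι j)))
  let L : ((Σ j, E (ι j)) → ℚ) →ₗ[ℚ] ((Σ i, E i) → ℚ) := LinearMap.pi Lx
  have hLapp : ∀ (h : (Σ j, E (ι j)) → ℚ) (x : Σ i, E i),
      L h x = (∑ j, φ x.1 j (fun t => h ⟨j, t⟩)) x.2 := fun h x => by
    simp only [L, Lx, LinearMap.pi_apply, LinearMap.comp_apply, LinearMap.proj_apply, LinearMap.sum_apply]
    rfl
  refine finrank_antiSpan_sigmaType_eq_reindex_of_leftInverse Φ ι L fun g => ?_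
  funext x
  obtain ⟨i, s⟩ := x
  rw [hLapp, antiVec_sigmaType]
  have hslot : ∀ j, (fun t => LinearMap.funLeft ℚ ℚ (fun y : (Σ j, E (ι j)) => (⟨ι y.1, y.2⟩ : Σ i, E i))
      (antiVec (sigmaType Φ) g) (⟨j, t⟩ : Σ j, E (ι j))) = antiVec (Φ (ι j)) g := fun j => by
    funext t
    rw [LinearMap.funLeft_apply, antiVec_sigmaType]
  simp only [hslot]
  have hφg : ∀ j, φ i j (antiVec (Φ (ι j)) g) = fun z => φ i j (antiVec (Φ (ι j)) (1 : G)) (g • z) := fun j =>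
    apply_antiVec_eq_comp_smul (Ψ := Φ (ι j)) (φ i j) (act := fun g z => g • z) (hφ i j) g
  simp only [hφg]
  rw [Finset.sum_apply]
  have key := congrFun (hgen i) (g • s)
  rw [Finset.sum_apply] at key
  rw [← key, antiVec_apply_smul, one_mul]

/-- **Sub-family form**: for a sub-family `{i // p i}`, if every type vector OFF `p` is an equivariant combination
`u_1(Φ_i) = Σ_{j : p j} φ_ij(u_1(Φ_j))` of the kept ones, then `dim U(Σ) = dim U(Σ|_p)`.
[cite: Gordon1999HodgeAVSurvey, §3 Theorem (proof) and 7.5–7.7] -/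
theorem finrank_antiSpan_sigmaType_eq_restrict_of_generated [Fintype I] [∀ i, Fintype (E i)]
    (Φ : ∀ i, Set (E i)) (p : I → Prop) [DecidablePred p]
    (φ : ∀ (i : I) (j : {i // p i}), (E j.1 → ℚ) →ₗ[ℚ] (E i → ℚ))
    (hφ : ∀ i j (g : G) (f : E j.1 → ℚ), φ i j (fun y => f (g • y)) = fun z => φ i j f (g • z))
    (hgen : ∀ i, ¬ p i → antiVec (Φ i) (1 : G) = ∑ j, φ i j (antiVec (Φ j.1) (1 : G))) :
    Module.finrank ℚ (antiSpan G (sigmaType Φ)) =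
      Module.finrank ℚ (antiSpan G (sigmaType fun j : {i // p i} => Φ j.1)) := by
  classical
  -- recombination: copy the kept slots, recombine the dropped ones
  let Lx : (Σ i, E i) → ((Σ j : {i // p i}, E j.1) → ℚ) →ₗ[ℚ] ℚ := fun x =>
    if hx : p x.1 then LinearMap.proj (⟨⟨x.1, hx⟩, x.2⟩ : Σ j : {i // p i}, E j.1)
    else (LinearMap.proj x.2 : (E x.1 → ℚ) →ₗ[ℚ] ℚ) ∘ₗ
      ∑ j, φ x.1 j ∘ₗ LinearMap.funLeft ℚ ℚ (fun t : E j.1 => (⟨j, t⟩ : Σ j : {i // p i}, E j.1))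
  let L : ((Σ j : {i // p i}, E j.1) → ℚ) →ₗ[ℚ] ((Σ i, E i) → ℚ) := LinearMap.pi Lx
  have hLp : ∀ (h : (Σ j : {i // p i}, E j.1) → ℚ) (i : I) (hi : p i) (s : E i),
      L h ⟨i, s⟩ = h ⟨⟨i, hi⟩, s⟩ := fun h i hi s => by
    simp only [L, Lx, LinearMap.pi_apply, dif_pos hi, LinearMap.proj_apply]
  have hLn : ∀ (h : (Σ j : {i // p i}, E j.1) → ℚ) (i : I) (hi : ¬ p i) (s : E i),
      L h ⟨i, s⟩ = (∑ j, φ i j (fun t => h ⟨j, t⟩)) s := fun h i hi s => by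
    simp only [L, Lx, LinearMap.pi_apply, dif_neg hi, LinearMap.comp_apply, LinearMap.proj_apply,
      LinearMap.sum_apply]
    rfl
  refine finrank_antiSpan_sigmaType_eq_reindex_of_leftInverse Φ (Subtype.val : {i // p i} → I) L fun g => ?_
  funext x
  obtain ⟨i, s⟩ := x
  by_cases hi : p i
  · rw [hLp _ i hi, LinearMap.funLeft_apply]
  · rw [hLn _ i hi, antiVec_sigmaType]
    have hslot : ∀ j : {i // p i}, (fun t => LinearMap.funLeft ℚ ℚ
        (fun y : (Σ j : {i // p i}, E j.1) => (⟨y.1.1, y.2⟩ : Σ i, E i))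
        (antiVec (sigmaType Φ) g) (⟨j, t⟩ : Σ j : {i // p i}, E j.1)) = antiVec (Φ j.1) g := fun j => by
      funext t
      rw [LinearMap.funLeft_apply, antiVec_sigmaType]
    simp only [hslot]
    have hφg : ∀ j : {i // p i}, φ i j (antiVec (Φ j.1) g) =
        fun z => φ i j (antiVec (Φ j.1) (1 : G)) (g • z) := fun j =>
      apply_antiVec_eq_comp_smul (Ψ := Φ j.1) (φ i j) (act := fun g z => g • z) (hφ i j) g
    simp only [hφg]
    rw [Finset.sum_apply]
    have key := congrFun (hgen i hi) (g • s)
    rw [Finset.sum_apply] at key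
    rw [← key, antiVec_apply_smul, one_mul]

end Generated

/-! ### §3 The converse: equal rank ⟹ the dropped type vectors are generated -/

section Converse

variable [Fintype I] [∀ i, Fintype (E i)] [Fintype J] [DecidableEq J]

/-- **EQUAL RANK ⟹ GENERATION.**  If `dim U(Σ) = dim U(Σ_ι)`, then every type vector of the family is an equivariant
combination of the reindexed ones: there are `G`-equivariant linear `φ_ij : ℚ^{E_{ι j}} → ℚ^{E_i}` with
`u_1(Φ_i) = Σ_j φ_ij(u_1(Φ_{ι j}))` for ALL `i`.  (The restriction `U(Σ) → U(Σ_ι)` is onto, hence an isomorphism by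
the dimension count; its inverse, precomposed with the EQUIVARIANT orthogonal projection of `ℚ^{⊔_j E_{ι j}}` onto
`U(Σ_ι)`, is an equivariant `ψ : ℚ^{⊔_j E_{ι j}} → ℚ^{⊔_i E_i}` with `ψ(u_1(Σ_ι)) = u_1(Σ)`; read it slot by slot,
`φ_ij = (ψ ∘ ext_j)|_{E_i}`, using `u_1(Σ_ι) = Σ_j ext_j u_1(Φ_{ι j})`.)
[cite: Serre1977, §1.3 Thm. 1] [cite: Gordon1999HodgeAVSurvey, §3 Theorem (proof) and 7.5–7.7] -/
theorem exists_generated_of_finrank_antiSpan_sigmaType_eq_reindex (Φ : ∀ i, Set (E i)) (ι : J → I)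
    (heq : Module.finrank ℚ (antiSpan G (sigmaType Φ)) =
      Module.finrank ℚ (antiSpan G (sigmaType fun j => Φ (ι j)))) :
    ∃ φ : ∀ (i : I) (j : J), (E (ι j) → ℚ) →ₗ[ℚ] (E i → ℚ),
      (∀ i j (g : G) (f : E (ι j) → ℚ), φ i j (fun y => f (g • y)) = fun z => φ i j f (g • z)) ∧
      ∀ i, antiVec (Φ i) (1 : G) = ∑ j, φ i j (antiVec (Φ (ι j)) (1 : G)) := by
  classical
  set R : ((Σ i, E i) → ℚ) →ₗ[ℚ] ((Σ j, E (ι j)) → ℚ) :=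
    LinearMap.funLeft ℚ ℚ (fun y : (Σ j, E (ι j)) => (⟨ι y.1, y.2⟩ : Σ i, E i)) with hRdef
  set M : Submodule ℚ ((Σ i, E i) → ℚ) := antiSpan G (sigmaType Φ) with hMdef
  set N : Submodule ℚ ((Σ j, E (ι j)) → ℚ) := antiSpan G (sigmaType fun j => Φ (ι j)) with hNdef
  have hMN : M.map R = N := by rw [hMdef, hRdef, hNdef]; exact map_funLeft_reindex_antiSpan_sigmaType Φ ι
  have hRmem : ∀ m : M, R m ∈ N := fun m => hMN ▸ Submodule.mem_map_of_mem m.2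
  -- the restriction `M → N` is bijective
  let R' : M →ₗ[ℚ] N := LinearMap.codRestrict N (R ∘ₗ M.subtype) hRmem
  have hR'surj : Function.Surjective R' := by
    rintro ⟨n, hn⟩
    rw [← hMN] at hn
    obtain ⟨m, hm, rfl⟩ := Submodule.mem_map.1 hn
    exact ⟨⟨m, hm⟩, rfl⟩
  have hR'inj : Function.Injective R' := by
    have hrange : LinearMap.range R' = ⊤ := LinearMap.range_eq_top.2 hR'surj
    have hsum := LinearMap.finrank_range_add_finrank_ker R'
    rw [hrange, finrank_top, ← heq] at hsum
    have hker : Module.finrank ℚ (LinearMap.ker R') = 0 := by omega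
    rw [← LinearMap.ker_eq_bot]
    exact Submodule.finrank_eq_zero.1 hker
  let e : M ≃ₗ[ℚ] N := LinearEquiv.ofBijective R' ⟨hR'inj, hR'surj⟩
  have he : ∀ m : M, (e m : (Σ j, E (ι j)) → ℚ) = R m := fun m => rfl
  have hesymm : ∀ (n : N), R (e.symm n : (Σ i, E i) → ℚ) = n := fun n => by
    have := he (e.symm n)
    rw [LinearEquiv.apply_symm_apply] at this
    exact this.symm
  -- stability
  have hMst : ∀ (g : G) (f : (Σ i, E i) → ℚ), f ∈ M → (fun x => f (g • x)) ∈ M :=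
    fun g f hf => comp_smul_mem_antiSpan hf g
  have hNst : ∀ (g : G) (f : (Σ j, E (ι j)) → ℚ), f ∈ N → (fun x => f (g • x)) ∈ N :=
    fun g f hf => comp_smul_mem_antiSpan hf g
  -- the equivariant projection onto `N`
  obtain ⟨Q, hQeq, hQmem, hQid⟩ := exists_equivariant_projection (G := G) N hNst
  have hQeq' : ∀ (g : G) (f : (Σ j, E (ι j)) → ℚ), Q (fun x => f (g • x)) = fun x => Q f (g • x) := fun g f => by
    simpa only [inv_inv] using hQeq g⁻¹ f
  let Q' : ((Σ j, E (ι j)) → ℚ) →ₗ[ℚ] N := LinearMap.codRestrict N Q hQmem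
  -- the equivariant lift `ψ`
  let ψ : ((Σ j, E (ι j)) → ℚ) →ₗ[ℚ] ((Σ i, E i) → ℚ) := M.subtype ∘ₗ (e.symm : N →ₗ[ℚ] M) ∘ₗ Q'
  have hψapp : ∀ h, ψ h = (e.symm (Q' h) : (Σ i, E i) → ℚ) := fun h => rfl
  have hψeq : ∀ (g : G) (h : (Σ j, E (ι j)) → ℚ), ψ (fun y => h (g • y)) = fun x => ψ h (g • x) := by
    intro g h
    rw [hψapp, hψapp]
    -- both sides lie in `M` and have the same restriction
    have hmemL : (e.symm (Q' fun y => h (g • y)) : (Σ i, E i) → ℚ) ∈ M := (e.symm _).2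
    have hmemR : (fun x => (e.symm (Q' h) : (Σ i, E i) → ℚ) (g • x)) ∈ M := hMst g _ (e.symm _).2
    have hRL : R (e.symm (Q' fun y => h (g • y)) : (Σ i, E i) → ℚ) = Q (fun y => h (g • y)) := hesymm _
    have hRR : R (fun x => (e.symm (Q' h) : (Σ i, E i) → ℚ) (g • x)) = Q (fun y => h (g • y)) := by
      rw [hRdef, funLeft_reindex_comp_smul, ← hRdef, hesymm, hQeq']
      rfl
    have hinj := hR'inj (a₁ := ⟨_, hmemL⟩) (a₂ := ⟨_, hmemR⟩) (Subtype.ext (hRL.trans hRR.symm))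
    exact congrArg Subtype.val hinj
  -- `ψ` lifts `u_1(Σ_ι)` to `u_1(Σ)`
  have hu : antiVec (sigmaType Φ) (1 : G) ∈ M := Submodule.subset_span ⟨1, rfl⟩
  have hRu : R (antiVec (sigmaType Φ) (1 : G)) = antiVec (sigmaType fun j => Φ (ι j)) (1 : G) := by
    rw [hRdef]; exact funLeft_reindex_antiVec_sigmaType Φ ι 1
  have hψu : ψ (antiVec (sigmaType fun j => Φ (ι j)) (1 : G)) = antiVec (sigmaType Φ) (1 : G) := by
    rw [hψapp]
    have hQ'u : Q' (antiVec (sigmaType fun j => Φ (ι j)) (1 : G)) = e ⟨antiVec (sigmaType Φ) (1 : G), hu⟩ := by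
      apply Subtype.ext
      show Q _ = (e ⟨antiVec (sigmaType Φ) (1 : G), hu⟩ : (Σ j, E (ι j)) → ℚ)
      rw [he, Submodule.coe_mk, hRu]
      exact hQid _ (Submodule.subset_span ⟨1, rfl⟩)
    rw [hQ'u, LinearEquiv.symm_apply_apply]
  -- read slot by slot
  refine ⟨fun i j => LinearMap.funLeft ℚ ℚ (fun s : E i => (⟨i, s⟩ : Σ i, E i)) ∘ₗ ψ ∘ₗ
      slotExt (E := fun j => E (ι j)) j, fun i j g f => ?_, fun i => ?_⟩
  · funext z
    simp only [LinearMap.comp_apply, LinearMap.funLeft_apply]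
    rw [← slotExt_comp_smul (E := fun j => E (ι j)) j f g, hψeq]
    rfl
  · have hsum : antiVec (sigmaType fun j => Φ (ι j)) (1 : G) =
        ∑ j, slotExt (E := fun j => E (ι j)) j (antiVec (Φ (ι j)) (1 : G)) := by
      rw [antiVec_sigmaType_eq_sigmaLift, sigmaLift_eq_sum_slotExt]
    funext s
    have := congrFun hψu ⟨i, s⟩
    rw [antiVec_sigmaType] at this
    rw [← this, hsum, map_sum, Finset.sum_apply, Finset.sum_apply]
    rfl

/-- **`dim U(Σ) = dim U(Σ_ι)` ⟺ every type vector is an equivariant combination of the reindexed ones.**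
[cite: Serre1977, §1.3 Thm. 1] [cite: Gordon1999HodgeAVSurvey, §3 Theorem (proof) and 7.5–7.7] -/
theorem finrank_antiSpan_sigmaType_eq_reindex_iff (Φ : ∀ i, Set (E i)) (ι : J → I) :
    Module.finrank ℚ (antiSpan G (sigmaType Φ)) = Module.finrank ℚ (antiSpan G (sigmaType fun j => Φ (ι j))) ↔
      ∃ φ : ∀ (i : I) (j : J), (E (ι j) → ℚ) →ₗ[ℚ] (E i → ℚ),
        (∀ i j (g : G) (f : E (ι j) → ℚ), φ i j (fun y => f (g • y)) = fun z => φ i j f (g • z)) ∧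
        ∀ i, antiVec (Φ i) (1 : G) = ∑ j, φ i j (antiVec (Φ (ι j)) (1 : G)) :=
  ⟨exists_generated_of_finrank_antiSpan_sigmaType_eq_reindex Φ ι, fun ⟨φ, hφ, hgen⟩ =>
    finrank_antiSpan_sigmaType_eq_reindex_of_generated Φ ι φ hφ hgen⟩

/-- **CM types: `rank(Σ) = rank(Σ_ι)` ⟺ every type vector is an equivariant combination of the reindexed ones** —
on Hodge groups, `Hg(∏_I A_i) → Hg(∏_J A_{ι j})` is an isogeny iff the type vectors of all factors are
`Aut`-equivariant images of those of the kept factors. [cite: Gordon1999HodgeAVSurvey, 7.5–7.7] [cite: Shimura1998, §32.10] -/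
theorem typeRank_sigmaType_eq_reindex_iff {ρ : G} {Φ : ∀ i, Set (E i)} (h : ∀ i, IsCMTypeWith ρ (Φ i))
    (ι : J → I) [Nonempty (Σ j, E (ι j))] :
    typeRank G (sigmaType Φ) = typeRank G (sigmaType fun j => Φ (ι j)) ↔
      ∃ φ : ∀ (i : I) (j : J), (E (ι j) → ℚ) →ₗ[ℚ] (E i → ℚ),
        (∀ i j (g : G) (f : E (ι j) → ℚ), φ i j (fun y => f (g • y)) = fun z => φ i j f (g • z)) ∧
        ∀ i, antiVec (Φ i) (1 : G) = ∑ j, φ i j (antiVec (Φ (ι j)) (1 : G)) := by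
  obtain ⟨⟨j₀, s₀⟩⟩ := ‹Nonempty (Σ j, E (ι j))›
  haveI : Nonempty (Σ i, E i) := ⟨⟨ι j₀, s₀⟩⟩
  rw [(IsCMTypeWith.sigmaType h).typeRank_eq_finrank_antiSpan_add_one,
    (IsCMTypeWith.sigmaType (E := fun j => E (ι j)) fun j => h (ι j)).typeRank_eq_finrank_antiSpan_add_one,
    Nat.add_right_cancel_iff]
  exact finrank_antiSpan_sigmaType_eq_reindex_iff Φ ι

end Converse

end Summit.HodgeConjecture.CorCM.IrrOdd

end
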